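import Mathlib.Algebra.Field.ZMod
import Summits.PneNP.PneNP.Theorems.SzkEntropyPeaThreeNotInPStubInstanceFP
import Literature.Computability.Complexity.GaussRankList

/-!
# Route SzkEntropy, crux `PeaThreeNotInP` (stmt-PneNP-10776), line `SketchIdeator3`, step S7:
# concise cores — objects (definitions only)

Step S7 of the tensor-isomorphism line removes the conciseness promise from the transfer
hypothesis: FULL 3-Tensor Isomorphism over `F₂` (`TensorIsoFull`: YES = isomorphic pairs, NO = ALL
non-isomorphic pairs, same instances and Boolean code as `TensorIso`) Karp-reduces to `TensorIso`
(NO side promised concise) by passing to CONCISE CORES [GrochowQiao2023, §2 (nondegenerate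
tensors; every tensor is isomorphic to a padding of a concise one, unique up to isomorphism)].
Objects posited here (no facts asserted):

* §1 `TensorIsoFull`.
* §2 rectangular multilinear multiplication `tmul P Q R X = P · X · (Q ⊗ R)ᵀ` (the action
  `tensorAct` with rectangular matrices), the cyclic rotation `rotT` of the three directions,
  support tensors `ofSupportN` of UNTYPED support lists, and the predicate `IsCoreOf S X`
  (`X` concise and `S = tmul P Q R X` with `P, Q, R` of full column rank).
* §3 the untyped core algorithm on support lists: one PASS (`denseRows`, the Gauss–Jordan list
  sweep `GaussRank.lrun` of `Literature/…/GaussRankList.lean`, the pivot rows `pivRows`, read back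
  as a support list with the directions ROTATED, `passN`), three passes `coreN`, the fixed concise
  non-isomorphic pair `fixedNoN` (unit tensor vs. W-tensor, format `2 × 2 × 2`), the untyped Karp
  map `coreMapN`, and its typed form `coreMap : TIInst → TIInst` (`ofRawTI ∘ coreMapN ∘ rawTI`).
The statements about these objects (pass/core correctness, uniqueness of cores up to isomorphism,
the three linear-algebra facts they rest on, the fixed pair, the `CodeFP` computation) are the
registered stubs of the skeleton `Cruxes/PeaThreeNotInP/Lines/SketchIdeator3.lean` (v4) and land as
`…CoreStub*.lean` theorem files.

Sources: J. A. Grochow, Y. Qiao, *On the complexity of isomorphism problems for tensors, groups,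
and polynomials I*, SIAM J. Comput. 52 (2023), §2; J. von zur Gathen, J. Gerhard, *Modern Computer
Algebra*, 3rd ed., CUP 2013, §12.1 (Gaussian elimination); the card
`Cruxes/PeaThreeNotInP/Ideas/tensor-iso-monoid-import.md` (S7 in the lead notes `Cruxes/…/NOTES.md`).
-/

noncomputable section

open Finset
open scoped Kronecker
open Matrix
open _root_.Computability
open Literature.InformationTheory.Entropy
open Literature.Computability.Complexity

namespace Summit.PneNP.PneNP.Cruxes.PeaThreeNotInP.TensorIsoLine

set_option linter.dupNamespace false -- `Summit.PneNP.PneNP.…`: summit = sub-problem name (D-0017 single-conjunct layout)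

/-! ### §1 Full 3-Tensor Isomorphism -/

/-- **FULL 3-TENSOR ISOMORPHISM over `F₂`** (a language, trivial promise): YES = isomorphic pairs,
NO = all non-isomorphic pairs; same instances `TIInst` and code as `TensorIso`.
[GrochowQiao2023, Def. 1.1 (3-Tensor Isomorphism)] -/
def TensorIsoFull : PromiseProblem :=
  PromiseProblem.ofEncoding TIInst.encoding {I | Iso I.fstT I.sndT} {I | ¬ Iso I.fstT I.sndT}

/-! ### §2 Rectangular multilinear multiplication, rotation, cores -/

variable {a b c a' b' c' : ℕ}

/-- Multilinear multiplication by RECTANGULAR matrices: `tmul P Q R X = P · X · (Q ⊗ R)ᵀ`, i.e.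
`(tmul P Q R X)_{i,(j,k)} = ∑ P_{i i'} Q_{j j'} R_{k k'} X_{i',(j',k')}` (`tensorAct (A,B,C)` is the square
case). [GrochowQiao2023, §2] -/
def tmul (P : Matrix (Fin a) (Fin a') (ZMod 2)) (Q : Matrix (Fin b) (Fin b') (ZMod 2))
    (R : Matrix (Fin c) (Fin c') (ZMod 2)) (X : Tensor3 a' b' c') : Tensor3 a b c :=
  P * X * (Q ⊗ₖ R)ᵀ

/-- Cyclic rotation of the directions: `(rotT T)_{j,(k,i)} = T_{i,(j,k)}` (format `a×b×c ↦ b×c×a`;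
three rotations are the identity, two rotations give the third flattening). [folklore] -/
def rotT (T : Tensor3 a b c) : Tensor3 b c a :=
  Matrix.of fun j p => T p.2 (j, p.1)

/-- Three rotations are the identity (registered sanity stub of the definitions file; used by the
core-composition stub to bring the directions back in place). [folklore] -/
theorem stub_rotT_three (T : Tensor3 a b c) : rotT (rotT (rotT T)) = T := by
  ext i jk
  rfl

/-- The `0/1` tensor of format `a × b × c` whose support is read off an UNTYPED list of index
triples `(i, j, k)` (membership of the values; out-of-range triples are ignored). [folklore] -/
def ofSupportN (a b c : ℕ) (L : List (ℕ × ℕ × ℕ)) : Tensor3 a b c :=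
  Matrix.of fun i jk => if (i.val, jk.1.val, jk.2.val) ∈ L then 1 else 0

/-- **`X` is a concise core of `S`**: `X` is concise and `S = tmul P Q R X` for matrices `P, Q, R`
of full column rank (injective changes of coordinates followed by zero padding).
[GrochowQiao2023, §2 (nondegenerate part of a tensor)] -/
def IsCoreOf {r₁ r₂ r₃ : ℕ} (S : Tensor3 a b c) (X : Tensor3 r₁ r₂ r₃) : Prop :=
  Concise X ∧ ∃ (P : Matrix (Fin a) (Fin r₁) (ZMod 2)) (Q : Matrix (Fin b) (Fin r₂) (ZMod 2))
    (R : Matrix (Fin c) (Fin r₃) (ZMod 2)), P.rank = r₁ ∧ Q.rank = r₂ ∧ R.rank = r₃ ∧ S = tmul P Q R X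

/-! ### §3 The untyped core algorithm -/

/-- The dense rows of the first flattening of the support tensor of `L`, one row per listed row
label `i` (with repetitions) over the listed column labels `(j, k)` (with repetitions):
entry `1` iff `(i, j, k) ∈ L`. [folklore] -/
def denseRows (L : List (ℕ × ℕ × ℕ)) : List (List (ZMod 2)) :=
  (L.map Prod.fst).map fun i => (L.map Prod.snd).map fun jk => if (i, jk) ∈ L then 1 else 0

/-- The Gauss–Jordan list sweep of the dense rows over all columns, no initial flags.
[von zur Gathen–Gerhard 2013, §12.1] -/
def sweep (L : List (ℕ × ℕ × ℕ)) : List (Bool × List (ZMod 2)) :=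
  GaussRank.lrun (L.map Prod.snd).length ((denseRows L).map fun r => (false, r))

/-- The pivot rows of the sweep (a basis of the row space of the first flattening).
[von zur Gathen–Gerhard 2013, §12.1] -/
def pivRows (L : List (ℕ × ℕ × ℕ)) : List (List (ZMod 2)) :=
  ((sweep L).filter fun br => br.1).map Prod.snd

/-- One pivot row read back as support triples with the directions ROTATED: the `i'`-th pivot row
contributes `(j, k, i')` for every column label `(j, k)` carrying a `1`. [folklore] -/
def readRow (cols : List (ℕ × ℕ)) (i' : ℕ) (row : List (ZMod 2)) : List (ℕ × ℕ × ℕ) :=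
  ((cols.zip row).filter fun e => decide (e.2 = 1)).map fun e => (e.1.1, e.1.2, i')

/-- **One pass**: reduce direction 1 of the support tensor of `L` (format `a × b × c`) to a basis
of its row space; output the number `r` of pivot rows and the support list of the resulting
`r × b × c` tensor written in the ROTATED format `b × c × r` (so that iterating the pass reduces
the directions in turn). [GrochowQiao2023, §2; von zur Gathen–Gerhard 2013, §12.1] -/
def passN (L : List (ℕ × ℕ × ℕ)) : ℕ × List (ℕ × ℕ × ℕ) :=
  ((pivRows L).length,
    ((pivRows L).mapIdx fun i' row => readRow (L.map Prod.snd) i' row).flatten)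

/-- **Three passes**: the formats `(r₁, r₂, r₃)` and the support list (format `r₁ × r₂ × r₃`, the
directions back in place after three rotations) of a concise core. [GrochowQiao2023, §2] -/
def coreN (L : List (ℕ × ℕ × ℕ)) : (ℕ × ℕ × ℕ) × List (ℕ × ℕ × ℕ) :=
  (((passN L).1, (passN (passN L).2).1, (passN (passN (passN L).2).2).1),
    (passN (passN (passN L).2).2).2)

/-- Support of the UNIT tensor `e₁⊗e₁⊗e₁ + e₂⊗e₂⊗e₂` of format `2 × 2 × 2`. [folklore] -/
def unitSuppN : List (ℕ × ℕ × ℕ) := [(0, 0, 0), (1, 1, 1)]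

/-- Support of the W-tensor `e₁⊗e₁⊗e₂ + e₁⊗e₂⊗e₁ + e₂⊗e₁⊗e₁` of format `2 × 2 × 2`. [folklore] -/
def wSuppN : List (ℕ × ℕ × ℕ) := [(0, 0, 1), (0, 1, 0), (1, 0, 0)]

/-- The unit tensor of format `2 × 2 × 2` (concise). [folklore] -/
def tU : Tensor3 2 2 2 := ofSupportN 2 2 2 unitSuppN

/-- The W-tensor of format `2 × 2 × 2` (concise, not isomorphic to `tU`). [folklore] -/
def tW : Tensor3 2 2 2 := ofSupportN 2 2 2 wSuppN

/-- Untyped TI instances: formats and two support lists of value triples (the shape of `rawTI`).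
[folklore] -/
abbrev RawTI : Type := ℕ × ℕ × ℕ × List (ℕ × ℕ × ℕ) × List (ℕ × ℕ × ℕ)

/-- The fixed concise non-isomorphic pair `(tU, tW)` as an untyped instance. [folklore] -/
def fixedNoN : RawTI := (2, 2, 2, unitSuppN, wSuppN)

/-- In-range test of a value triple against formats `q = (a, b, c)`. [folklore] -/
def inRangeN (q : ℕ × ℕ × ℕ) (p : ℕ × ℕ × ℕ) : Bool :=
  decide (p.1 < q.1) && (decide (p.2.1 < q.2.1) && decide (p.2.2 < q.2.2))

/-- Drop out-of-range triples of both support lists (harmless for `ofSupportN`; makes the untyped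
map commute with `rawTI` on the nose). [folklore] -/
def clampN (y : RawTI) : RawTI :=
  (y.1, y.2.1, y.2.2.1, y.2.2.2.1.filter (inRangeN (y.1, y.2.1, y.2.2.1)),
    y.2.2.2.2.filter (inRangeN (y.1, y.2.1, y.2.2.1)))

/-- **The untyped Karp map**: the two cores if their formats agree, else the fixed concise
non-isomorphic pair (clamped). [GrochowQiao2023, §2] -/
def coreMapN (x : RawTI) : RawTI :=
  clampN (if (coreN x.2.2.2.1).1 = (coreN x.2.2.2.2).1 then
    ((coreN x.2.2.2.1).1.1, (coreN x.2.2.2.1).1.2.1, (coreN x.2.2.2.1).1.2.2,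
      (coreN x.2.2.2.1).2, (coreN x.2.2.2.2).2)
    else fixedNoN)

/-- A value triple as a typed index triple of formats `a, b, c`, if in range. [folklore] -/
def finT (a b c : ℕ) (p : ℕ × ℕ × ℕ) : Option (Fin a × Fin b × Fin c) :=
  if h : p.1 < a ∧ p.2.1 < b ∧ p.2.2 < c then some (⟨p.1, h.1⟩, ⟨p.2.1, h.2.1⟩, ⟨p.2.2, h.2.2⟩)
  else none

/-- The typed instance of an untyped one (out-of-range triples dropped). [folklore] -/
def ofRawTI (y : RawTI) : TIInst :=
  ⟨y.1, y.2.1, y.2.2.1, y.2.2.2.1.filterMap (finT y.1 y.2.1 y.2.2.1),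
    y.2.2.2.2.filterMap (finT y.1 y.2.1 y.2.2.1)⟩

/-- **The Karp map of S7** `TensorIsoFull ≤ₚ TensorIso`: typed form of `coreMapN`.
[GrochowQiao2023, §2] -/
def coreMap (I : TIInst) : TIInst :=
  ofRawTI (coreMapN (rawTI I))

end Summit.PneNP.PneNP.Cruxes.PeaThreeNotInP.TensorIsoLine

end
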